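import Summits.HubbardSuperconductivity.HubbardSuperconductivity.Theorems.AnisotropyChordStiffnessOperatorLink
import Summits.HubbardSuperconductivity.HubbardSuperconductivity.Theorems.AnisotropyChordVirialMonotone

/-!
# Route `AnisotropyChord`, crux `FerroSideChord` (stmt-HubbardSuperconductivity-19089):
# continuity of the sector order parameter `Λ_L(Δ)` in the anisotropy `Δ`

Notation of the route: `H_L(Δ) = xxzHamiltonian 1 (torusGraph 2 L) (-1) Δ` (`= hcbHamiltonian L Δ`),
`K_M = spinZSector 1 M` a magnetisation sector, `Λ(ψ) = Re⟨ψ, S⁺_tot S⁻_tot ψ⟩`.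

For every `L`, every sector label `M` and every real `Δ` the sector ground state of the stoquastic,
sector-irreducible `H_L(Δ)` is unique up to a phase (Perron–Frobenius, tree
`Stiffness.sectorGround_eq_smul_perron`), so `Λ` takes ONE value `Λ(Δ) = lowerNormSq a_Δ` on the
normalised sector ground states (`a_Δ` the Perron amplitude, tree
`Stiffness.lambda_eq_lowerNormSq_of_sectorGround`).  This file proves that `Δ ↦ a_Δ` — hence
`Δ ↦ Λ(Δ)` — is CONTINUOUS, by an explicit gap estimate (used by piece C `FerroSideChordEndpoints`
of the range split of the crux, file `AnisotropyChordFerroSideChordEndpoints`):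

* `energy_ge_of_gap` — abstract: if `A = Aᴴ` has the unit ground vector `ψ₀ ∈ K` (`Aψ₀ = eψ₀`) with a
  gap `g` on `K ∩ ψ₀^⊥`, then every unit `ψ ∈ K` with real overlap `c = ⟨ψ₀, ψ⟩` has
  `e + g(1 - c²) ≤ Re⟨ψ, Aψ⟩`;
* `perron_gap` — the gap above the sector energy of `H_L(Δ₀)` on `K ∩ a_{Δ₀}^⊥`
  (`EigenvalueContinuation.exists_gap_of_unique` + Perron uniqueness);
* `sectorGS_form_le_of_pencil` — variational: a unit sector ground state `ψ` of `H_L(Δ)` has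
  `Re⟨ψ, H_L(Δ₀)ψ⟩ ≤ E₀(Δ₀) + 2D|Δ - Δ₀|`, `D = Σᵢₖ |(H_L(1) - H_L(0))ᵢₖ|` (affine pencil);
* `perron_overlap_deficit_le`, `perron_dist_sq_le` — `g(1 - ⟨a_{Δ₀}, a_Δ⟩²) ≤ 2D|Δ - Δ₀|` and
  `Σ_σ (a_Δ σ - a_{Δ₀} σ)² ≤ 2(1 - ⟨a_{Δ₀}, a_Δ⟩²)` (both amplitudes are non-negative);
* `perron_lowerNormSq_continuousAt`, `sectorGS_lambda_continuousAt` — `ε/δ` continuity of `Λ` at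
  every `Δ₀` across ALL normalised sector ground states.

Elementary finite-dimensional perturbation theory (T. Kato, *Perturbation Theory for Linear
Operators* (1966) II-§1.4, §5.1; H. Tasaki, *Physics and Mathematics of Quantum Many-Body Systems*
(2020) §2.2, App. A.2).  No definition is introduced.
-/

set_option linter.dupNamespace false

noncomputable section

open Matrix Complex Finset Filter Topology
open scoped ComplexConjugate
open Literature.MathematicalPhysics.QuantumLattice hiding torusPhase torusNorm
open Literature.Probability.LatticeModels
open Summit.HubbardSuperconductivity.HubbardSuperconductivity.Theorems.AnisotropyChord.InsertionEntropy
open Summit.HubbardSuperconductivity.HubbardSuperconductivity.Theorems.AnisotropyChord.Stiffness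

namespace Summit.HubbardSuperconductivity.HubbardSuperconductivity.Theorems.AnisotropyChord.FerroSide

/-! ### Abstract gap estimate -/

/-- **Energy of a unit vector above a gapped simple ground state.**  `A = Aᴴ`, `ψ₀ ∈ K` a unit
vector with `Aψ₀ = eψ₀` and gap `g` on `K ∩ ψ₀^⊥` (`(e+g)‖w‖² ≤ Re⟨w, Aw⟩`); then every unit `ψ ∈ K`
whose overlap `⟨ψ₀, ψ⟩ = c` is real satisfies `e + g(1 - c²) ≤ Re⟨ψ, Aψ⟩` (write `ψ = cψ₀ + w`).
Kato (1966) II-§1.4; Tasaki (2020) App. A.2. [folklore] -/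
theorem energy_ge_of_gap {ι : Type*} [Fintype ι] {A : Matrix ι ι ℂ} (hA : Aᴴ = A)
    (K : Submodule ℂ (ι → ℂ)) {e g c : ℝ} {ψ₀ ψ : ι → ℂ}
    (hψ₀K : ψ₀ ∈ K) (hψ₀1 : star ψ₀ ⬝ᵥ ψ₀ = 1) (hAψ₀ : A *ᵥ ψ₀ = (e : ℂ) • ψ₀)
    (hgap : ∀ w ∈ K, star ψ₀ ⬝ᵥ w = 0 → (e + g) * (star w ⬝ᵥ w).re ≤ (star w ⬝ᵥ A *ᵥ w).re)
    (hψK : ψ ∈ K) (hψ1 : star ψ ⬝ᵥ ψ = 1) (hc : star ψ₀ ⬝ᵥ ψ = (c : ℂ)) :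
    e + g * (1 - c ^ 2) ≤ (star ψ ⬝ᵥ A *ᵥ ψ).re := by
  set w : ι → ℂ := ψ - (c : ℂ) • ψ₀ with hw
  have hwK : w ∈ K := K.sub_mem hψK (K.smul_mem _ hψ₀K)
  have hψψ₀ : star ψ ⬝ᵥ ψ₀ = (c : ℂ) := by
    rw [star_dotProduct, hc, Complex.star_def, Complex.conj_ofReal]
  have horth : star ψ₀ ⬝ᵥ w = 0 := by
    rw [hw, dotProduct_sub, dotProduct_smul, hψ₀1, hc, smul_eq_mul, mul_one, sub_self]
  have hψ₀Aψ : star ψ₀ ⬝ᵥ A *ᵥ ψ = (e : ℂ) * c := by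
    rw [EigenvalueContinuation.star_dotProduct_mulVec_comm hA, hAψ₀, dotProduct_smul, hψψ₀,
      smul_eq_mul, star_mul', Complex.star_def, Complex.conj_ofReal, Complex.conj_ofReal]
  have hψAψ₀ : star ψ ⬝ᵥ A *ᵥ ψ₀ = (e : ℂ) * c := by
    rw [hAψ₀, dotProduct_smul, hψψ₀, smul_eq_mul]
  have hψ₀Aψ₀ : star ψ₀ ⬝ᵥ A *ᵥ ψ₀ = (e : ℂ) := by
    rw [hAψ₀, dotProduct_smul, hψ₀1, smul_eq_mul, mul_one]
  have hww : star w ⬝ᵥ w = 1 - (c : ℂ) ^ 2 := by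
    rw [hw, star_sub, star_smul, sub_dotProduct, dotProduct_sub, dotProduct_sub, smul_dotProduct,
      smul_dotProduct, dotProduct_smul, dotProduct_smul, hψ1, hψψ₀, hc, hψ₀1]
    simp only [Complex.star_def, Complex.conj_ofReal, smul_eq_mul]
    ring
  have hwAw : star w ⬝ᵥ A *ᵥ w = star ψ ⬝ᵥ A *ᵥ ψ - (e : ℂ) * (c : ℂ) ^ 2 := by
    rw [hw, mulVec_sub, mulVec_smul, star_sub, star_smul, sub_dotProduct, dotProduct_sub,
      dotProduct_sub, smul_dotProduct, smul_dotProduct, dotProduct_smul, dotProduct_smul, hψAψ₀,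
      hψ₀Aψ, hψ₀Aψ₀]
    simp only [Complex.star_def, Complex.conj_ofReal, smul_eq_mul]
    ring
  have key := hgap w hwK horth
  rw [hww, hwAw] at key
  have h1 : ((1 : ℂ) - (c : ℂ) ^ 2).re = 1 - c ^ 2 := by
    rw [← Complex.ofReal_pow, ← Complex.ofReal_one, ← Complex.ofReal_sub, Complex.ofReal_re]
  have h2 : (star ψ ⬝ᵥ A *ᵥ ψ - (e : ℂ) * (c : ℂ) ^ 2).re = (star ψ ⬝ᵥ A *ᵥ ψ).re - e * c ^ 2 := by
    rw [Complex.sub_re, ← Complex.ofReal_pow, ← Complex.ofReal_mul, Complex.ofReal_re]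
  rw [h1, h2] at key
  nlinarith [key]

/-! ### The torus XXZ family: Perron amplitudes, the gap, the pencil -/

variable (L : ℕ) [NeZero L]

/-- `⟨toC a, toC b⟩ = Σ_σ a σ · b σ` (real amplitudes). [folklore] -/
theorem star_toC_dotProduct_toC (a b : TensorIndex (TorusSite 2 L) 2 → ℝ) :
    star (toC L a) ⬝ᵥ toC L b = ((∑ σ, a σ * b σ : ℝ) : ℂ) := by
  unfold dotProduct toC
  push_cast
  refine Finset.sum_congr rfl fun σ _ => ?_
  rw [Pi.star_apply, Complex.star_def, Complex.conj_ofReal]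

/-- A Perron sector ground amplitude is a unit vector: `⟨toC a, toC a⟩ = 1`. [folklore] -/
theorem toC_unit_of_isPerron {Δ M : ℝ} {a : TensorIndex (TorusSite 2 L) 2 → ℝ}
    (ha : IsPerronSectorGroundAmplitude L Δ M a) : star (toC L a) ⬝ᵥ toC L a = 1 := by
  rw [star_toC_dotProduct_toC]
  have h : (∑ σ, a σ * a σ) = ∑ σ, a σ ^ 2 := Finset.sum_congr rfl fun σ _ => by ring
  rw [h, ha.unit, Complex.ofReal_one]

/-- A Perron sector ground amplitude is non-zero as a complex vector. [folklore] -/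
theorem toC_ne_zero_of_isPerron {Δ M : ℝ} {a : TensorIndex (TorusSite 2 L) 2 → ℝ}
    (ha : IsPerronSectorGroundAmplitude L Δ M a) : toC L a ≠ 0 := by
  intro h0
  have h1 := toC_unit_of_isPerron L ha
  rw [h0, dotProduct_zero] at h1
  exact zero_ne_one h1

/-- The eigen-equation of a Perron amplitude in `hcbHamiltonian` / `toC` currency. [folklore] -/
theorem hcb_mulVec_toC_of_isPerron {Δ M : ℝ} {a : TensorIndex (TorusSite 2 L) 2 → ℝ}
    (ha : IsPerronSectorGroundAmplitude L Δ M a) :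
    hcbHamiltonian L Δ *ᵥ toC L a =
      ((lowestEnergyInSector 1 (hcbHamiltonian L Δ) M : ℝ) : ℂ) • toC L a :=
  ha.eigen

/-- The sector membership of a Perron amplitude in `toC` currency. [folklore] -/
theorem toC_mem_of_isPerron {Δ M : ℝ} {a : TensorIndex (TorusSite 2 L) 2 → ℝ}
    (ha : IsPerronSectorGroundAmplitude L Δ M a) :
    toC L a ∈ spinZSector (Λ := TorusSite 2 L) 1 M :=
  ha.sector

/-- **The gap above the sector energy** of `H_L(Δ₀)` on `K_M ∩ a^⊥` for the Perron amplitude `a`: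
some `g > 0` with `(E₀ + g)‖w‖² ≤ Re⟨w, H_L(Δ₀)w⟩` for every `w ∈ K_M` orthogonal to `toC a`
(simplicity of the sector ground state, `sectorGround_eq_smul_perron`, and compactness,
`EigenvalueContinuation.exists_gap_of_unique`). Kato (1966) II-§1.4. [folklore] -/
theorem perron_gap (Δ₀ M : ℝ) (a : TensorIndex (TorusSite 2 L) 2 → ℝ)
    (ha : IsPerronSectorGroundAmplitude L Δ₀ M a) :
    ∃ g : ℝ, 0 < g ∧ ∀ w ∈ spinZSector (Λ := TorusSite 2 L) 1 M, star (toC L a) ⬝ᵥ w = 0 →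
      (lowestEnergyInSector 1 (hcbHamiltonian L Δ₀) M + g) * (star w ⬝ᵥ w).re ≤
        (star w ⬝ᵥ hcbHamiltonian L Δ₀ *ᵥ w).re := by
  have hH := xxzHamiltonian_isHermitian 1 (torusGraph 2 L) (-1) Δ₀
  exact EigenvalueContinuation.exists_gap_of_unique hH.eq (spinZSector (Λ := TorusSite 2 L) 1 M)
    (fun v hv => hcb_mulVec_mem_spinZSector L Δ₀ M hv)
    (fun v hv => minEnergyOn_mul_le_re_rayleigh hH (spinZSector (Λ := TorusSite 2 L) 1 M) hv)
    (toC_ne_zero_of_isPerron L ha) (hcb_mulVec_toC_of_isPerron L ha)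
    (fun φ hφK hHφ => sectorGround_eq_smul_perron L Δ₀ M a ha hφK hHφ)

/-- The size of the Ising slope of the pencil: `D = Σᵢₖ |(H_L(1) - H_L(0))ᵢₖ|` bounds
`|Re⟨b, (H_L(1) - H_L(0)) b⟩|` for every unit vector `b`. [folklore] -/
theorem abs_isingForm_le (b : TensorIndex (TorusSite 2 L) 2 → ℂ) (hb : star b ⬝ᵥ b = 1) :
    |(star b ⬝ᵥ ((hcbHamiltonian L 1 - hcbHamiltonian L 0) *ᵥ b)).re| ≤
      ∑ i, ∑ k, ‖(hcbHamiltonian L 1 - hcbHamiltonian L 0) i k‖ :=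
  abs_re_rayleigh_le_sum_norm _ hb

/-- **Variational bound along the pencil.**  A unit sector ground state `ψ` of `H_L(Δ)` and a unit
sector ground state `ψ₀` of `H_L(Δ₀)` in the same sector satisfy
`Re⟨ψ, H_L(Δ₀)ψ⟩ ≤ E₀(Δ₀) + 2D·|Δ - Δ₀|` (`E₀(Δ) ≤ ⟨ψ₀, H_L(Δ)ψ₀⟩`, the pencil is affine, and
both Ising forms are bounded by `D`). Tasaki (2020) App. A.2. [folklore] -/
theorem sectorGS_form_le_of_pencil {Δ Δ₀ M : ℝ} {ψ ψ₀ : TensorIndex (TorusSite 2 L) 2 → ℂ}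
    (hψ1 : star ψ ⬝ᵥ ψ = 1)
    (hHψ : hcbHamiltonian L Δ *ᵥ ψ = ((lowestEnergyInSector 1 (hcbHamiltonian L Δ) M : ℝ) : ℂ) • ψ)
    (hψ₀K : ψ₀ ∈ spinZSector (Λ := TorusSite 2 L) 1 M) (hψ₀1 : star ψ₀ ⬝ᵥ ψ₀ = 1)
    (hHψ₀ : hcbHamiltonian L Δ₀ *ᵥ ψ₀ =
      ((lowestEnergyInSector 1 (hcbHamiltonian L Δ₀) M : ℝ) : ℂ) • ψ₀) :
    (star ψ ⬝ᵥ hcbHamiltonian L Δ₀ *ᵥ ψ).re ≤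
      lowestEnergyInSector 1 (hcbHamiltonian L Δ₀) M +
        2 * (∑ i, ∑ k, ‖(hcbHamiltonian L 1 - hcbHamiltonian L 0) i k‖) * |Δ - Δ₀| := by
  set D := ∑ i, ∑ k, ‖(hcbHamiltonian L 1 - hcbHamiltonian L 0) i k‖ with hD
  set b := (star ψ ⬝ᵥ ((hcbHamiltonian L 1 - hcbHamiltonian L 0) *ᵥ ψ)).re with hb
  set b₀ := (star ψ₀ ⬝ᵥ ((hcbHamiltonian L 1 - hcbHamiltonian L 0) *ᵥ ψ₀)).re with hb₀
  have hbD : |b| ≤ D := abs_isingForm_le L ψ hψ1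
  have hb₀D : |b₀| ≤ D := abs_isingForm_le L ψ₀ hψ₀1
  -- the pencil is affine: forms at `Δ₀` and at `Δ`
  have hψΔ₀ := re_form_affine 1 (torusGraph 2 L) (-1) Δ₀ ψ
  have hψΔ := re_form_affine 1 (torusGraph 2 L) (-1) Δ ψ
  have hψ₀Δ₀ := re_form_affine 1 (torusGraph 2 L) (-1) Δ₀ ψ₀
  have hψ₀Δ := re_form_affine 1 (torusGraph 2 L) (-1) Δ ψ₀
  -- energies of the ground states and the variational bound
  have heψ := re_form_of_sectorGS 1 (torusGraph 2 L) hψ1 hHψ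
  have heψ₀ := re_form_of_sectorGS 1 (torusGraph 2 L) hψ₀1 hHψ₀
  have hvar := sectorEnergy_le_re_form 1 (torusGraph 2 L) (J := -1) (Δ := Δ) hψ₀K hψ₀1
  -- `Re⟨ψ, H(Δ₀)ψ⟩ = E(Δ) + (Δ₀ - Δ) b ≤ E₀ + (Δ - Δ₀) b₀ + (Δ₀ - Δ) b`
  have h1 : (star ψ ⬝ᵥ hcbHamiltonian L Δ₀ *ᵥ ψ).re =
      lowestEnergyInSector 1 (hcbHamiltonian L Δ) M + (Δ₀ - Δ) * b := by
    rw [← heψ]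
    show (star ψ ⬝ᵥ (xxzHamiltonian 1 (torusGraph 2 L) (-1) Δ₀ *ᵥ ψ)).re =
      (star ψ ⬝ᵥ (xxzHamiltonian 1 (torusGraph 2 L) (-1) Δ *ᵥ ψ)).re + (Δ₀ - Δ) * b
    rw [hψΔ₀, hψΔ, hb]
    ring
  have h2 : lowestEnergyInSector 1 (hcbHamiltonian L Δ) M ≤
      lowestEnergyInSector 1 (hcbHamiltonian L Δ₀) M + (Δ - Δ₀) * b₀ := by
    rw [← heψ₀]
    show lowestEnergyInSector 1 (xxzHamiltonian 1 (torusGraph 2 L) (-1) Δ) M ≤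
      (star ψ₀ ⬝ᵥ (xxzHamiltonian 1 (torusGraph 2 L) (-1) Δ₀ *ᵥ ψ₀)).re + (Δ - Δ₀) * b₀
    rw [hψ₀Δ₀]
    rw [hψ₀Δ] at hvar
    rw [hb₀]
    linarith
  have h3 : (Δ - Δ₀) * b₀ + (Δ₀ - Δ) * b ≤ 2 * D * |Δ - Δ₀| := by
    have e1 : (Δ - Δ₀) * b₀ ≤ |Δ - Δ₀| * D := by
      calc (Δ - Δ₀) * b₀ ≤ |(Δ - Δ₀) * b₀| := le_abs_self _
        _ = |Δ - Δ₀| * |b₀| := abs_mul _ _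
        _ ≤ |Δ - Δ₀| * D := mul_le_mul_of_nonneg_left hb₀D (abs_nonneg _)
    have e2 : (Δ₀ - Δ) * b ≤ |Δ - Δ₀| * D := by
      calc (Δ₀ - Δ) * b ≤ |(Δ₀ - Δ) * b| := le_abs_self _
        _ = |Δ₀ - Δ| * |b| := abs_mul _ _
        _ = |Δ - Δ₀| * |b| := by rw [abs_sub_comm]
        _ ≤ |Δ - Δ₀| * D := mul_le_mul_of_nonneg_left hbD (abs_nonneg _)
    linarith
  rw [h1]
  linarith

/-- **Overlap deficit of two Perron amplitudes.**  For Perron amplitudes `a₀` at `Δ₀` and `a` at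
`Δ` (same `L`, same sector) and the gap `g` of `perron_gap` at `Δ₀`:
`g·(1 - ⟨a₀, a⟩²) ≤ 2D·|Δ - Δ₀|`. Kato (1966) II-§5.1 (finite-dimensional form). [folklore] -/
theorem perron_overlap_deficit_le {Δ Δ₀ M : ℝ} {a a₀ : TensorIndex (TorusSite 2 L) 2 → ℝ}
    (ha : IsPerronSectorGroundAmplitude L Δ M a) (ha₀ : IsPerronSectorGroundAmplitude L Δ₀ M a₀)
    {g : ℝ}
    (hgap : ∀ w ∈ spinZSector (Λ := TorusSite 2 L) 1 M, star (toC L a₀) ⬝ᵥ w = 0 →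
      (lowestEnergyInSector 1 (hcbHamiltonian L Δ₀) M + g) * (star w ⬝ᵥ w).re ≤
        (star w ⬝ᵥ hcbHamiltonian L Δ₀ *ᵥ w).re) :
    g * (1 - (∑ σ, a₀ σ * a σ) ^ 2) ≤
      2 * (∑ i, ∑ k, ‖(hcbHamiltonian L 1 - hcbHamiltonian L 0) i k‖) * |Δ - Δ₀| := by
  have hH := xxzHamiltonian_isHermitian 1 (torusGraph 2 L) (-1) Δ₀
  have hlow := energy_ge_of_gap hH.eq (spinZSector (Λ := TorusSite 2 L) 1 M)
    (toC_mem_of_isPerron L ha₀) (toC_unit_of_isPerron L ha₀) (hcb_mulVec_toC_of_isPerron L ha₀)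
    hgap (toC_mem_of_isPerron L ha) (toC_unit_of_isPerron L ha) (star_toC_dotProduct_toC L a₀ a)
  have hup := sectorGS_form_le_of_pencil L (toC_unit_of_isPerron L ha)
    (hcb_mulVec_toC_of_isPerron L ha) (toC_mem_of_isPerron L ha₀) (toC_unit_of_isPerron L ha₀)
    (hcb_mulVec_toC_of_isPerron L ha₀)
  linarith

/-- **Distance of two Perron amplitudes from their overlap.**  Non-negative unit amplitudes `a`, `a₀`
have `Σ_σ (a σ - a₀ σ)² = 2(1 - ⟨a₀, a⟩) ≤ 2(1 - ⟨a₀, a⟩²)` (`0 ≤ ⟨a₀, a⟩ ≤ 1`). [folklore] -/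
theorem perron_dist_sq_le {Δ Δ₀ M : ℝ} {a a₀ : TensorIndex (TorusSite 2 L) 2 → ℝ}
    (ha : IsPerronSectorGroundAmplitude L Δ M a) (ha₀ : IsPerronSectorGroundAmplitude L Δ₀ M a₀) :
    ∑ σ, (a σ - a₀ σ) ^ 2 ≤ 2 * (1 - (∑ σ, a₀ σ * a σ) ^ 2) := by
  set c := ∑ σ, a₀ σ * a σ with hc
  have hc0 : 0 ≤ c := Finset.sum_nonneg fun σ _ => mul_nonneg (ha₀.nonneg σ) (ha.nonneg σ)
  have hexp : ∑ σ, (a σ - a₀ σ) ^ 2 = 2 - 2 * c := by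
    have h : ∀ σ, (a σ - a₀ σ) ^ 2 = a σ ^ 2 + a₀ σ ^ 2 - 2 * (a₀ σ * a σ) := fun σ => by ring
    simp_rw [h]
    rw [Finset.sum_sub_distrib, Finset.sum_add_distrib, ha.unit, ha₀.unit, ← Finset.mul_sum, ← hc]
    ring
  have hc1 : c ≤ 1 := by
    have h0 : 0 ≤ ∑ σ, (a σ - a₀ σ) ^ 2 := Finset.sum_nonneg fun σ _ => sq_nonneg _
    rw [hexp] at h0
    linarith
  rw [hexp]
  nlinarith [mul_nonneg hc0 (sub_nonneg.2 hc1)]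

/-- `lowerNormSq` (`= ‖S⁻_tot ψ‖²`, a polynomial in the amplitudes) is continuous. [folklore] -/
theorem continuous_lowerNormSq {V : Type} [Fintype V] [DecidableEq V] :
    Continuous fun a : (V → Fin 2) → ℝ => lowerNormSq a := by
  unfold lowerNormSq lowerSum
  refine continuous_finsetSum _ fun τ _ => ?_
  refine (continuous_finsetSum _ fun x _ => ?_).pow 2
  split_ifs
  · exact continuous_apply _
  · exact continuous_const

/-- **Continuity of the order parameter along Perron amplitudes.**  For a Perron amplitude `a₀`
at `Δ₀` and `ε > 0` there is `δ > 0` such that every Perron amplitude `a` (same `L`, same sector) at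
any `Δ` with `|Δ - Δ₀| < δ` has `|lowerNormSq a - lowerNormSq a₀| < ε`.  Kato (1966) II-§5.1
(continuity of a simple eigenprojection), finite-dimensional. [folklore] -/
theorem perron_lowerNormSq_continuousAt (Δ₀ M : ℝ) (a₀ : TensorIndex (TorusSite 2 L) 2 → ℝ)
    (ha₀ : IsPerronSectorGroundAmplitude L Δ₀ M a₀) :
    ∀ ε > (0 : ℝ), ∃ δ > (0 : ℝ), ∀ (Δ : ℝ) (a : TensorIndex (TorusSite 2 L) 2 → ℝ),
      |Δ - Δ₀| < δ → IsPerronSectorGroundAmplitude L Δ M a →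
        |lowerNormSq a - lowerNormSq a₀| < ε := by
  intro ε hε
  -- continuity of `lowerNormSq` at `a₀` in the sup metric
  obtain ⟨η, hη, hcont⟩ := Metric.continuous_iff.mp
    (continuous_lowerNormSq (V := TorusSite 2 L)) a₀ ε hε
  -- the gap at `Δ₀`
  obtain ⟨g, hg, hgap⟩ := perron_gap L Δ₀ M a₀ ha₀
  set D := ∑ i, ∑ k, ‖(hcbHamiltonian L 1 - hcbHamiltonian L 0) i k‖ with hD
  have hD0 : 0 ≤ D := Finset.sum_nonneg fun i _ => Finset.sum_nonneg fun k _ => norm_nonneg _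
  refine ⟨g * η ^ 2 / (4 * D + 4), by positivity, fun Δ a hΔ ha => ?_⟩
  have hdef := perron_overlap_deficit_le L ha ha₀ hgap
  have hdist := perron_dist_sq_le L ha ha₀
  -- `Σ (a - a₀)² < η²`
  have hsq : ∑ σ, (a σ - a₀ σ) ^ 2 < η ^ 2 := by
    have h1 : g * (∑ σ, (a σ - a₀ σ) ^ 2) ≤ 4 * D * |Δ - Δ₀| := by
      calc g * (∑ σ, (a σ - a₀ σ) ^ 2) ≤ g * (2 * (1 - (∑ σ, a₀ σ * a σ) ^ 2)) :=
            mul_le_mul_of_nonneg_left hdist hg.le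
        _ = 2 * (g * (1 - (∑ σ, a₀ σ * a σ) ^ 2)) := by ring
        _ ≤ 2 * (2 * D * |Δ - Δ₀|) := by linarith
        _ = 4 * D * |Δ - Δ₀| := by ring
    have h2 : 4 * D * |Δ - Δ₀| ≤ (4 * D + 4) * |Δ - Δ₀| :=
      mul_le_mul_of_nonneg_right (by linarith) (abs_nonneg _)
    have h3 : (4 * D + 4) * |Δ - Δ₀| < (4 * D + 4) * (g * η ^ 2 / (4 * D + 4)) :=
      mul_lt_mul_of_pos_left hΔ (by positivity)
    have h4 : (4 * D + 4) * (g * η ^ 2 / (4 * D + 4)) = g * η ^ 2 := by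
      field_simp
    have h5 : g * (∑ σ, (a σ - a₀ σ) ^ 2) < g * η ^ 2 := by linarith
    exact lt_of_mul_lt_mul_left h5 hg.le
  -- hence `dist a a₀ < η` in the sup metric
  have hda : dist a a₀ < η := by
    rw [dist_pi_lt_iff hη]
    intro σ
    rw [Real.dist_eq]
    refine abs_lt_of_sq_lt_sq ?_ hη.le
    calc (a σ - a₀ σ) ^ 2 ≤ ∑ τ, (a τ - a₀ τ) ^ 2 :=
          Finset.single_le_sum (f := fun τ => (a τ - a₀ τ) ^ 2) (fun τ _ => sq_nonneg _)
            (Finset.mem_univ σ)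
      _ < η ^ 2 := hsq
  have := hcont a hda
  rwa [Real.dist_eq] at this

/-- The `S^z`-sector containing a unit vector is non-trivial. [folklore] -/
theorem spinZSector_ne_bot_of_unit {M : ℝ} {ψ : TensorIndex (TorusSite 2 L) 2 → ℂ}
    (hψK : ψ ∈ spinZSector (Λ := TorusSite 2 L) 1 M) (hψ1 : star ψ ⬝ᵥ ψ = 1) :
    spinZSector (Λ := TorusSite 2 L) 1 M ≠ ⊥ := by
  intro hbot
  rw [hbot, Submodule.mem_bot] at hψK
  rw [hψK, dotProduct_zero] at hψ1
  exact zero_ne_one hψ1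

/-- **Continuity of `Λ` in `Δ` across all sector ground states.**  For a normalised sector-`M`
ground state `ψ₀` of `H_L(Δ₀)` and `ε > 0` there is `δ > 0` such that every normalised sector-`M`
ground state `ψ` of `H_L(Δ)`, `|Δ - Δ₀| < δ`, has `|Λ(ψ) - Λ(ψ₀)| < ε`.  Kato (1966) II-§5.1,
finite-dimensional. [folklore] -/
theorem sectorGS_lambda_continuousAt {Δ₀ M : ℝ} {ψ₀ : TensorIndex (TorusSite 2 L) 2 → ℂ}
    (h₀K : ψ₀ ∈ spinZSector (Λ := TorusSite 2 L) 1 M) (h₀1 : star ψ₀ ⬝ᵥ ψ₀ = 1)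
    (h₀H : hcbHamiltonian L Δ₀ *ᵥ ψ₀ =
      ((lowestEnergyInSector 1 (hcbHamiltonian L Δ₀) M : ℝ) : ℂ) • ψ₀) :
    ∀ ε > (0 : ℝ), ∃ δ > (0 : ℝ), ∀ (Δ : ℝ) (ψ : TensorIndex (TorusSite 2 L) 2 → ℂ),
      |Δ - Δ₀| < δ → ψ ∈ spinZSector (Λ := TorusSite 2 L) 1 M → star ψ ⬝ᵥ ψ = 1 →
        hcbHamiltonian L Δ *ᵥ ψ = ((lowestEnergyInSector 1 (hcbHamiltonian L Δ) M : ℝ) : ℂ) • ψ →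
          |(star ψ ⬝ᵥ (((∑ x : TorusSite 2 L, onSite x (spinRaise 1)) *
              (∑ y : TorusSite 2 L, onSite y (spinLower 1)) : Op (TorusSite 2 L) 2) *ᵥ ψ)).re -
            (star ψ₀ ⬝ᵥ (((∑ x : TorusSite 2 L, onSite x (spinRaise 1)) *
              (∑ y : TorusSite 2 L, onSite y (spinLower 1)) : Op (TorusSite 2 L) 2) *ᵥ ψ₀)).re| < ε := by
  intro ε hε
  have hK := spinZSector_ne_bot_of_unit L h₀K h₀1
  obtain ⟨a₀, ha₀⟩ := exists_perronAmplitude L Δ₀ M hK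
  obtain ⟨δ, hδ, hcont⟩ := perron_lowerNormSq_continuousAt L Δ₀ M a₀ ha₀ ε hε
  refine ⟨δ, hδ, fun Δ ψ hΔ hψK hψ1 hψH => ?_⟩
  obtain ⟨a, ha⟩ := exists_perronAmplitude L Δ M hK
  rw [lambda_eq_lowerNormSq_of_sectorGround Δ M a ha ψ hψK hψ1 hψH,
    lambda_eq_lowerNormSq_of_sectorGround Δ₀ M a₀ ha₀ ψ₀ h₀K h₀1 h₀H]
  exact hcont Δ a hΔ ha

end Summit.HubbardSuperconductivity.HubbardSuperconductivity.Theorems.AnisotropyChord.FerroSide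

end
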